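import Summits.QuantumAdvantage.QuantumAdvantage.Theorems.OddPrimeWalkClassBlind
import Summits.QuantumAdvantage.AdviceFreeQNC0.EliminationHardnessF
import Summits.QuantumAdvantage.AdviceFreeQNC0.LinearSelections
import Literature.Computability.MetaComplexity.SmolenskyCorrelationRestrict
import HarnessLib

/-!
# The CROSS-SKETCH LAW of the odd-prime u-walk game (TypeDial, part A1: the dial, bookkeeping, balance, transport)

decomp-qadv lens-1 g19 (node HOME/decomp-qadv-lens-1/g19/TypeDial.lean, NODE-g19.md).  At a separator `m`, a strategy is
NARROW of width `k` and degree `D` (`NarrowAt`) when the cuts `g ≤ m` see the bits `≥ m` only through `k` Boolean sketch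
functions of `𝔽_p`-degree `≤ D` and the cuts `g > m` see the bits `< m` only through `k` such functions (own side arbitrary).
`crossSketchLaw` (every prime `p ≠ 3`): `k·D ≤ c₀·√(min side)` ⇒ `#LOSE ≥ η·2ⁿ` at every charge.  PROOF = the class-blind
pair law `OddConfig.classBlind_mul_le_card_lose` + Smolensky level-set elimination `elimLevelSqrtF` applied to the avoidance
function of the sketch partition (`balance_core`).  COROLLARY `fewSignaturesSqrtLaw`: the `√n`-regime of the signature law
(item 24167's hypotheses with `ZMod 5 ↦ ZMod p`).  Support toward item 23109 `ManyReadersSqrtOdd` (part B proves its NARROW piece).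
-/

set_option linter.unusedVariables false
set_option linter.unusedSectionVars false
set_option linter.dupNamespace false

noncomputable section

namespace Summit.QuantumAdvantage.QuantumAdvantage.Theorems.TypeDial

open Finset Classical
open Summit.QuantumAdvantage.AdviceFreeQNC0
open Summit.QuantumAdvantage.AdviceFreeQNC0.OddConfig
open Literature.Computability.MetaComplexity

/-! ## §0 The dial: two-way low-degree cross sketches at a separator -/

/-- **Narrow cross-talk at separator `m`, width `k`, degree `D`.**  There are `k` Boolean sketch functions `bA i`
(what Bob may learn about Alice's half) and `k` functions `bB i` (what Alice may learn about Bob's half), all of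
`𝔽_p`-degree `≤ D`, such that every cut `g ≤ m` is a function of (bits `< m`, the values `bB i` of the bits `≥ m`) and every
cut `g > m` a function of (bits `≥ m`, the values `bA i` of the bits `< m`).  (`fun i => if i.val < m then s i else t i`
is `OddConfig.glue m s t`.) -/
def NarrowAt (p : ℕ) [Fact p.Prime] (n m k D : ℕ) (y : Fin (n + 1) → (Fin n → Bool) → Bool) : Prop :=
  ∃ bA bB : Fin k → (Fin n → Bool) → Bool,
    (∀ i, HasDegF p (bA i) D) ∧ (∀ i, HasDegF p (bB i) D) ∧
    (∀ g : Fin (n + 1), g.val ≤ m → ∀ s t t' : Fin n → Bool, (∀ i, bB i t = bB i t') →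
      y g (fun i => if i.val < m then s i else t i) = y g (fun i => if i.val < m then s i else t' i)) ∧
    (∀ g : Fin (n + 1), m < g.val → ∀ s s' t : Fin n → Bool, (∀ i, bA i s = bA i s') →
      y g (fun i => if i.val < m then s i else t i) = y g (fun i => if i.val < m then s' i else t i))

/-- **Narrow cross-talk (grade LOW)**: at SOME balanced separator `m ∈ [n/4, 3n/4]` the strategy has two-way sketches of
width `k` with `k² (log₂ n)^(2C+2) ≤ n` and degree `(log₂ n)^C`. -/
def NarrowCrossTalk (p : ℕ) [Fact p.Prime] (n C : ℕ) (y : Fin (n + 1) → (Fin n → Bool) → Bool) : Prop :=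
  ∃ m k : ℕ, n ≤ 4 * m ∧ 4 * m ≤ 3 * n ∧ k ^ 2 * Nat.log 2 n ^ (2 * C + 2) ≤ n ∧ NarrowAt p n m k (Nat.log 2 n ^ C) y

/-! ## §2 Low-degree bookkeeping: literals, atoms, level sets (`1 ∈ lowDeg`, products: `Smolensky.one_mem_lowDeg` / `Smolensky.prod_mem_lowDeg` of `Literature/…/RazborovSmolenskyPoly`) -/

section Atoms

variable {p : ℕ} [Fact p.Prime] {L k : ℕ}

/-- the literal indicator `[B i v = b]` has the degree of `B i`. -/
theorem lit_mem_lowDeg (B : Fin k → (Fin L → Bool) → Bool) {D : ℕ}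
    (hB : ∀ i, (fun v => if B i v then (1 : ZMod p) else 0) ∈ Smolensky.lowDeg (ZMod p) L D) (i : Fin k) (b : Bool) :
    (fun v => if B i v = b then (1 : ZMod p) else 0) ∈ Smolensky.lowDeg (ZMod p) L D := by
  cases b with
  | true => exact hB i
  | false =>
    have e : (fun v => if B i v = false then (1 : ZMod p) else 0) =
        (1 : Smolensky.CubeFn (ZMod p) L) - fun v => if B i v then (1 : ZMod p) else 0 := by
      funext v; simp only [Pi.sub_apply, Pi.one_apply]; cases B i v <;> simp
    rw [e]; exact Submodule.sub_mem _ (Smolensky.one_mem_lowDeg D) (hB i)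

/-- the ATOM indicator `[(B i v)_i = l]` of the sketch partition has `𝔽_p`-degree `≤ k·D`. -/
theorem atom_mem_lowDeg (B : Fin k → (Fin L → Bool) → Bool) {D : ℕ}
    (hB : ∀ i, (fun v => if B i v then (1 : ZMod p) else 0) ∈ Smolensky.lowDeg (ZMod p) L D) (l : Fin k → Bool) :
    (fun v => if (fun i => B i v) = l then (1 : ZMod p) else 0) ∈ Smolensky.lowDeg (ZMod p) L (k * D) := by
  have e : (fun v => if (fun i => B i v) = l then (1 : ZMod p) else 0) =
      ∏ i : Fin k, (fun v => if B i v = l i then (1 : ZMod p) else 0) := by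
    funext v
    rw [Finset.prod_apply]
    simp only [Finset.prod_boole, Finset.mem_univ, true_implies]
    by_cases h : (fun i => B i v) = l
    · rw [if_pos h, if_pos (fun i => congrFun h i)]
    · rw [if_neg h, if_neg (fun h' => h (funext h'))]
  rw [e]
  have h := Smolensky.prod_mem_lowDeg (Finset.univ : Finset (Fin k))
    (u := fun i => fun v => if B i v = l i then (1 : ZMod p) else 0) (D := D)
    (fun i _ => lit_mem_lowDeg B hB i (l i))
  rw [Finset.card_univ, Fintype.card_fin] at h
  exact h

/-- LEVEL SETS of any function of the sketch value are unions of atoms: degree `≤ k·D`. -/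
theorem levelSet_mem_lowDeg (B : Fin k → (Fin L → Bool) → Bool) {D : ℕ}
    (hB : ∀ i, (fun v => if B i v then (1 : ZMod p) else 0) ∈ Smolensky.lowDeg (ZMod p) L D)
    (φ : (Fin k → Bool) → ℕ) (r : ℕ) :
    (fun v => if φ (fun i => B i v) % 3 = r % 3 then (1 : ZMod p) else 0) ∈ Smolensky.lowDeg (ZMod p) L (k * D) := by
  have e : (fun v => if φ (fun i => B i v) % 3 = r % 3 then (1 : ZMod p) else 0) =
      ∑ l ∈ (Finset.univ.filter fun l : Fin k → Bool => φ l % 3 = r % 3),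
        (fun v => if (fun i => B i v) = l then (1 : ZMod p) else 0) := by
    funext v
    simp only [Finset.sum_apply]
    rw [Finset.sum_ite_eq]
    simp only [Finset.mem_filter, Finset.mem_univ, true_and]
  rw [e]
  exact Submodule.sum_mem _ fun l _ => atom_mem_lowDeg B hB l

end Atoms

/-! ## §3 Balance of the sketch partition on a cube (`elimLevelSqrtF` applied to the avoidance function) -/

section Balance

variable {L k : ℕ}

/-- number of points of `{0,1}^L` with sketch value `l` and weight class `a (mod 3)`. -/
def cubeCell (B : Fin k → (Fin L → Bool) → Bool) (l : Fin k → Bool) (a : ℕ) : ℕ :=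
  (Finset.univ.filter fun v : Fin L → Bool => (fun i => B i v) = l ∧ Hegedus.wt v % 3 = a).card

/-- the minimum of three values. -/
def min3 (f : ℕ → ℕ) : ℕ := min (min (f 0) (f 1)) (f 2)

/-- an index in `{0,1,2}` where `f` is minimal. -/
def amin (f : ℕ → ℕ) : ℕ := if f 0 ≤ f 1 ∧ f 0 ≤ f 2 then 0 else if f 1 ≤ f 2 then 1 else 2

/-- `amin f < 3`. -/
theorem amin_lt (f : ℕ → ℕ) : amin f < 3 := by
  unfold amin; split_ifs <;> omega

/-- `f (amin f) = min3 f`: `amin` picks an index attaining the minimum of `f 0, f 1, f 2`. -/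
theorem apply_amin (f : ℕ → ℕ) : f (amin f) = min3 f := by
  unfold amin min3
  split_ifs <;> omega

end Balance

/-- **`balance_core`** — on the cube `{0,1}^L`, a sketch of `k` Boolean functions of `𝔽_p`-degree `≤ D` with `k·D ≤ c₀√L`
has BALANCED MASS `Σ_l min_a |atom l ∩ class a| ≥ η₀·2^L` (`p ≠ 3`; `η₀, c₀` those of `elimLevelSqrtF`).
PROOF: the avoidance function `e v := amin (cells of v's atom)` has level sets of degree `≤ k·D` (`levelSet_mem_lowDeg`),
so by `elimLevelSqrtF` it names the true class on `≥ η₀·2^L` points; and `#{e ≡ wt} = Σ_l min-cell` fibrewise. -/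
theorem balance_core (p : ℕ) [Fact p.Prime] (hp3 : p ≠ 3) :
    ∃ η₀ : ℝ, 0 < η₀ ∧ ∃ c₀ : ℝ, 0 < c₀ ∧ ∃ m₀ : ℕ, ∀ L ≥ m₀, ∀ k D : ℕ, ((k * D : ℕ) : ℝ) ≤ c₀ * Real.sqrt L →
      ∀ B : Fin k → (Fin L → Bool) → Bool,
        (∀ i, (fun v => if B i v then (1 : ZMod p) else 0) ∈ Smolensky.lowDeg (ZMod p) L D) →
        η₀ * (2 : ℝ) ^ L ≤ ((∑ l : Fin k → Bool, min3 (cubeCell B l) : ℕ) : ℝ) := by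
  obtain ⟨η₀, hη₀, c₀, hc₀, n₀, H⟩ := elimLevelSqrtF p hp3
  refine ⟨η₀, hη₀, c₀, hc₀, n₀, fun L hL k D hkD B hB => ?_⟩
  have hlev : ∀ r : ℕ, (fun u => if (fun v : Fin L → Bool => amin (cubeCell B (fun i => B i v))) u % 3 = r % 3
      then (1 : ZMod p) else 0) ∈ Smolensky.lowDeg (ZMod p) L (k * D) :=
    fun r => levelSet_mem_lowDeg B hB (fun l => amin (cubeCell B l)) r
  have hmain := H L hL (k * D) hkD (fun v : Fin L → Bool => amin (cubeCell B (fun i => B i v))) hlev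
  have hcount : (Finset.univ.filter fun u : Fin L → Bool =>
      (fun v : Fin L → Bool => amin (cubeCell B (fun i => B i v))) u % 3 = Hegedus.wt u % 3).card =
      ∑ l : Fin k → Bool, min3 (cubeCell B l) := by
    rw [Finset.card_eq_sum_card_fiberwise (f := fun u : Fin L → Bool => (fun i => B i u)) (t := Finset.univ)
      (fun _ _ => Finset.mem_univ _)]
    refine Finset.sum_congr rfl fun l _ => ?_
    rw [← apply_amin (cubeCell B l)]
    unfold cubeCell
    congr 1
    ext u
    simp only [Finset.mem_filter, Finset.mem_univ, true_and]
    constructor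
    · rintro ⟨h1, h2⟩
      subst h2
      refine ⟨rfl, ?_⟩
      rw [Nat.mod_eq_of_lt (amin_lt _)] at h1
      exact h1.symm
    · rintro ⟨h2, h1⟩
      subst h2
      refine ⟨?_, rfl⟩
      rw [Nat.mod_eq_of_lt (amin_lt _)]
      exact h1.symm
  rw [hcount] at hmain
  exact hmain

/-! ## §4 Transport between the separator halves and the cubes -/

section Transport

variable {n m k : ℕ}

/-- substituting the Alice-side extension at a coordinate. -/
theorem extA_subst (m : ℕ) : ∀ i : Fin n,
    (∃ b, ∀ x : Fin m → Bool, extA (n := n) m x i = b) ∨ (∃ j, ∀ x : Fin m → Bool, extA (n := n) m x i = x j) := by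
  intro i
  by_cases h : i.val < m
  · exact Or.inr ⟨⟨i.val, h⟩, fun x => by simp [extA, h]⟩
  · exact Or.inl ⟨false, fun x => by simp [extA, h]⟩

/-- substituting the Bob-side extension at a coordinate. -/
theorem extB_subst (m : ℕ) : ∀ i : Fin n,
    (∃ b, ∀ x : Fin (n - m) → Bool, extB (n := n) m x i = b) ∨
      (∃ j, ∀ x : Fin (n - m) → Bool, extB (n := n) m x i = x j) := by
  intro i
  by_cases h : m ≤ i.val
  · exact Or.inr ⟨⟨i.val - m, by have := i.isLt; omega⟩, fun x => by simp [extB, h]⟩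
  · exact Or.inl ⟨false, fun x => by simp [extB, h]⟩

/-- degree transport to Alice's cube. -/
theorem hasDeg_extA {p : ℕ} [Fact p.Prime] {D : ℕ} {b : (Fin n → Bool) → Bool} (hb : HasDegF p b D) (m : ℕ) :
    (fun v : Fin m → Bool => if b (extA m v) then (1 : ZMod p) else 0) ∈ Smolensky.lowDeg (ZMod p) m D :=
  Smolensky.comp_subst_mem_lowDeg (extA (n := n) m) (extA_subst m) hb

/-- degree transport to Bob's cube. -/
theorem hasDeg_extB {p : ℕ} [Fact p.Prime] {D : ℕ} {b : (Fin n → Bool) → Bool} (hb : HasDegF p b D) (m : ℕ) :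
    (fun v : Fin (n - m) → Bool => if b (extB m v) then (1 : ZMod p) else 0) ∈ Smolensky.lowDeg (ZMod p) (n - m) D :=
  Smolensky.comp_subst_mem_lowDeg (extB (n := n) m) (extB_subst m) hb

/-- membership in an Alice-side cell of the sketch partition. -/
theorem mem_cellA_iff {ΛA : Type} [Fintype ΛA] {κA : (Fin n → Bool) → ΛA} {l : ΛA} {a : ℕ}
    {s : Fin n → Bool} : s ∈ cellA m κA l a ↔ s ∈ Aset n m ∧ κA s = l ∧ wtA m s % 3 = a := by
  simp only [cellA, Finset.mem_filter]

/-- membership in a Bob-side cell of the sketch partition. -/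
theorem mem_cellB_iff {ΛB : Type} [Fintype ΛB] {κB : (Fin n → Bool) → ΛB} {l : ΛB} {b : ℕ}
    {t : Fin n → Bool} : t ∈ cellB m κB l b ↔ t ∈ Bset n m ∧ κB t = l ∧ wtB m t % 3 = b := by
  simp only [cellB, Finset.mem_filter]

/-- membership in a cube cell: the atom of `v` is `l` and its class is `a`. -/
theorem mem_cubeCell_iff {L : ℕ} {B : Fin k → (Fin L → Bool) → Bool} {l : Fin k → Bool} {a : ℕ} {v : Fin L → Bool} :
    v ∈ (Finset.univ.filter fun v : Fin L → Bool => (fun i => B i v) = l ∧ Hegedus.wt v % 3 = a) ↔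
      (fun i => B i v) = l ∧ Hegedus.wt v % 3 = a := by
  simp only [Finset.mem_filter, Finset.mem_univ, true_and]

/-- Alice cells ↔ cube cells. -/
theorem card_cellA_eq (hm : m ≤ n) (bA : Fin k → (Fin n → Bool) → Bool) (l : Fin k → Bool) (a : ℕ) :
    (cellA m (fun s : Fin n → Bool => fun i => bA i s) l a).card =
      cubeCell (fun i (v : Fin m → Bool) => bA i (extA m v)) l a := by
  unfold cubeCell
  refine Finset.card_nbij' (resA hm) (extA m) ?_ ?_ ?_ ?_
  · intro s hs
    obtain ⟨hsA, hl, hw⟩ := mem_cellA_iff.mp (Finset.mem_coe.mp hs)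
    refine Finset.mem_coe.mpr (mem_cubeCell_iff.mpr ⟨?_, ?_⟩)
    · show (fun i => bA i (extA m (resA hm s))) = l
      rw [extA_resA hm hsA]; exact hl
    · show wt (resA hm s) % 3 = a
      rw [wt_resA hm]; exact hw
  · intro v hv
    obtain ⟨hl, hw⟩ := mem_cubeCell_iff.mp (Finset.mem_coe.mp hv)
    refine Finset.mem_coe.mpr (mem_cellA_iff.mpr ⟨extA_mem_Aset v, hl, ?_⟩)
    change wt v % 3 = a at hw
    rw [← wt_resA hm, resA_extA hm]; exact hw
  · intro s hs
    exact extA_resA hm (mem_cellA_iff.mp (Finset.mem_coe.mp hs)).1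
  · intro v _; exact resA_extA hm v

/-- Bob cells ↔ cube cells. -/
theorem card_cellB_eq (hm : m ≤ n) (bB : Fin k → (Fin n → Bool) → Bool) (l : Fin k → Bool) (b : ℕ) :
    (cellB m (fun t : Fin n → Bool => fun i => bB i t) l b).card =
      cubeCell (fun i (v : Fin (n - m) → Bool) => bB i (extB m v)) l b := by
  unfold cubeCell
  refine Finset.card_nbij' (resB m) (extB m) ?_ ?_ ?_ ?_
  · intro t ht
    obtain ⟨htB, hl, hw⟩ := mem_cellB_iff.mp (Finset.mem_coe.mp ht)
    refine Finset.mem_coe.mpr (mem_cubeCell_iff.mpr ⟨?_, ?_⟩)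
    · show (fun i => bB i (extB m (resB m t))) = l
      rw [extB_resB htB]; exact hl
    · show wt (resB m t) % 3 = b
      rw [wt_resB hm]; exact hw
  · intro v hv
    obtain ⟨hl, hw⟩ := mem_cubeCell_iff.mp (Finset.mem_coe.mp hv)
    refine Finset.mem_coe.mpr (mem_cellB_iff.mpr ⟨extB_mem_Bset v, hl, ?_⟩)
    change wt v % 3 = b at hw
    rw [← wt_resB hm, resB_extB]; exact hw
  · intro t ht
    exact extB_resB (mem_cellB_iff.mp (Finset.mem_coe.mp ht)).1
  · intro v _; exact resB_extB v

end Transport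

end Summit.QuantumAdvantage.QuantumAdvantage.Theorems.TypeDial
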